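import Literature.NumberTheory.Automorphic.CMTorusRegularAE
import HarnessLib

/-!
# Non-regular elements of the diagonal torus of `U(Φ₃)(L⁺_v)` are Haar-null — all three walls
# (Steinhaus; Rogawski 1990 §4.9, §12.5 «the regular set has full measure»; Harish-Chandra 1970)

Topic `NumberTheory/Automorphic`; namespace `Literature.NumberTheory.Automorphic.UnitaryGroup`.  THEOREMS ONLY (no definition, no instance, no notation, no
named fact, no `sorry`).  Cell `pub/hodgecm-mathlib`, line «CMCharIdentityTest» (F0P3b `Cruxes/H413/Lines/F0_P3b_CMCharIdentityTestPaydown.lean` ED. 12), desk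
F0P3b-plan (g12) FORWARD DEAL 2026-09-01T07:31:16Z, S-lemma **(L1)** of the (N-492)∕(N-492S) road, second instalment.  ★ `ae_isUnit_torusRatio_sub_one_three`
(`CMTorusRegularAE`) removes the walls `{(d₀⁻¹d₁)_w = 1}` and `{(d₀⁻¹d₂)_w = 1}` (the binders `ha`, `hb` of the torus descent); the canonical orbital-integral
formula ★ `classOrbitalIntegral_eq_smul_integral_prod_of_torus_regular` (`UnitaryGroupTorusOrbitalIntegralCanonical`, binder `hreg`) needs moreover ALL pairwise
differences `dᵢ − dⱼ` (`i ≠ j`) to be units of `∏_{w ∣ v} L_w` (regular semisimple in `GL₃`), i.e. also the third wall `{(d₁⁻¹d₂)_w = 1}`.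
* **`ae_isUnit_torusRatio_sub_one_three_one_two`**: for every Haar `μ_T` on `T₃ = (cmBorelTriple L 3 v).M`, `μ_T`-a.e. `t` has `d₁⁻¹d₂ − 1` a unit;
* **`ae_isUnit_torusEntry_sub_three`**: `μ_T`-a.e. `t`, every `dᵢ − dⱼ` (`i ≠ j`) is a unit AND `d₀⁻¹d₁ − 1`, `d₀⁻¹d₂ − 1` are units — exactly the binders
  `(hreg, ha', hb')` of ★ `classOrbitalIntegral_eq_smul_integral_prod_of_torus_regular` with `d i := torusEntry i t` (`hd` from `t.2`);
* **`ae_isUnit_torusEntry_sub_two`**: on `T₂ = (cmBorelTriple L 2 v).M`, `μ_T`-a.e. `t` has `d₀ − d₁` and `d₀⁻¹d₁ − 1` units.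
Proof: as in ★ `CMTorusRegularAE` — the wall `{(d₁⁻¹d₂)_w = 1}` is a closed subgroup avoided eventually by `d(U_k, 1, U_k⁻¹) → 1` (ratio `U_k⁻¹`), hence not a
neighbourhood of `1`, hence null (★ `measure_subgroup_eq_zero_of_tendsto`); `dᵢ − dⱼ = dᵢ · (dᵢ⁻¹dⱼ − 1)` up to sign.  Every finite place `v`.
HONEST LABEL: HC_CM is proved only modulo the printed citations (2 remaining named inputs hLiu418, h413) until rung 0 closes; this file pays no letter by itself.

## References
* [Rogawski1990] J. D. Rogawski, *Automorphic Representations of Unitary Groups in Three Variables* (1990), §1.10 p. 9, §4.9 p. 55, §12.5 p. 183.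
* [HarishChandra1970] Harish-Chandra, *Harmonic analysis on reductive p-adic groups*, LNM 162 (1970), §§3–5 (regular set of full measure).
* [Folland1995] G. B. Folland, *A Course in Abstract Harmonic Analysis* (1995), Prop. 2.4 (Steinhaus).
-/

set_option autoImplicit false

noncomputable section

open NumberField IsDedekindDomain MeasureTheory MeasureTheory.Measure Topology Filter
open scoped MatrixGroups

namespace Literature.NumberTheory.Automorphic

namespace UnitaryGroup

/-! ## §5 The third wall `{(d₁⁻¹d₂)_w = 1}` and the pairwise-difference form -/

section Three

variable (L : Type) [Field L] [NumberField L] [IsCMField L] (v : HeightOneSpectrum (𝓞 ↥(maximalRealSubfield L)))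

/-- The kernel `{t ∈ T | (d_i⁻¹ d_j)(t)_w = 1}` of a coordinate ratio read at a place `w ∣ v`, as a subgroup of the torus of `U(σ_v, J)(∏_w L_w)`.
(Private packaging of ★ `torusEntry`; used only in this file.) [cite: Rogawski1990, §1.10 p. 9] -/
private theorem exists_subgroup_ratio_apply_eq_one_aux {N : ℕ} (J : Matrix (Fin N) (Fin N) (LocalRing L v)) (i j : Fin N) (w : PlacesOver L v) :
    ∃ H : Subgroup ↥(torusU (conjLocal L (IsCMField.complexConj L) v) J),
      (∀ t, t ∈ H ↔ (((torusEntry (conjLocal L (IsCMField.complexConj L) v) J i t)⁻¹ *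
        torusEntry (conjLocal L (IsCMField.complexConj L) v) J j t : (LocalRing L v)ˣ) : LocalRing L v) w = 1) ∧
      IsClosed (H : Set ↥(torusU (conjLocal L (IsCMField.complexConj L) v) J)) := by
  let φ : ↥(torusU (conjLocal L (IsCMField.complexConj L) v) J) →* w.1.adicCompletion L :=
    (Pi.evalMonoidHom (fun w' : PlacesOver L v => w'.1.adicCompletion L) w).comp
      ((Units.coeHom (LocalRing L v)).comp
        ((torusEntry (conjLocal L (IsCMField.complexConj L) v) J i)⁻¹ * torusEntry (conjLocal L (IsCMField.complexConj L) v) J j))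
  have hφ : ∀ t, φ t = (((torusEntry (conjLocal L (IsCMField.complexConj L) v) J i t)⁻¹ *
      torusEntry (conjLocal L (IsCMField.complexConj L) v) J j t : (LocalRing L v)ˣ) : LocalRing L v) w := fun _ => rfl
  refine ⟨φ.ker, fun t => by rw [MonoidHom.mem_ker, hφ], ?_⟩
  have hc : Continuous φ := by
    have : (φ : _ → w.1.adicCompletion L) = fun t => (((torusEntry (conjLocal L (IsCMField.complexConj L) v) J i t)⁻¹ *
        torusEntry (conjLocal L (IsCMField.complexConj L) v) J j t : (LocalRing L v)ˣ) : LocalRing L v) w := funext hφ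
    rw [this]
    exact (continuous_apply w).comp (continuous_coe_torusEntry_inv_mul (conjLocal L (IsCMField.complexConj L) v) J i j)
  have hset : ((φ.ker : Subgroup _) : Set ↥(torusU (conjLocal L (IsCMField.complexConj L) v) J)) = φ ⁻¹' {1} := by
    ext t; simp [MonoidHom.mem_ker]
  rw [hset]
  exact isClosed_singleton.preimage hc

/-- For units `x, y` of a commutative ring: `x⁻¹y − 1` a unit ⇒ `x − y` and `y − x` units (`y − x = x (x⁻¹y − 1)`). [cite: Rogawski1990, §4.9 p. 55] -/
theorem isUnit_sub_of_isUnit_inv_mul_sub_one {R : Type*} [CommRing R] (x y : Rˣ) (h : IsUnit (((x⁻¹ * y : Rˣ) : R) - 1)) :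
    IsUnit ((x : R) - y) ∧ IsUnit ((y : R) - x) := by
  have hyx : (y : R) - x = (x : R) * ((((x⁻¹ * y : Rˣ) : R)) - 1) := by
    rw [Units.val_mul, mul_sub, mul_one, ← mul_assoc, Units.mul_inv, one_mul]
  have h2 : IsUnit ((y : R) - x) := by rw [hyx]; exact (Units.isUnit x).mul h
  exact ⟨by rw [← neg_sub]; exact h2.neg, h2⟩

set_option maxHeartbeats 800000 in
/-- **The third wall is Haar-null**: for every Haar measure `μ_T` on `T₃ = (cmBorelTriple L 3 v).M`, `μ_T`-almost every `t = d(d₀, d₁, d₂)` has `d₁⁻¹d₂ − 1`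
a unit of `∏_{w ∣ v} L_w`. [cite: Rogawski1990, §4.9 p. 55; §12.5 p. 183] [cite: HarishChandra1970, §3] -/
theorem ae_isUnit_torusRatio_sub_one_three_one_two
    [MeasurableSpace ↥(unitaryGroupOfForm (conjLocal L (IsCMField.complexConj L) v) (cmLocalForm L 3 v))]
    [BorelSpace ↥(unitaryGroupOfForm (conjLocal L (IsCMField.complexConj L) v) (cmLocalForm L 3 v))]
    (μT : Measure ↥(cmBorelTriple L 3 v).M) [μT.IsHaarMeasure] :
    ∀ᵐ t ∂μT,
      IsUnit ((((torusEntry (conjLocal L (IsCMField.complexConj L) v) (cmLocalForm L 3 v) 1 t)⁻¹ *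
          torusEntry (conjLocal L (IsCMField.complexConj L) v) (cmLocalForm L 3 v) 2 t : (LocalRing L v)ˣ) : LocalRing L v) - 1) := by
    -- instances on `G₃` and its torus
  haveI : LocallyCompactSpace ↥(unitaryGroupOfForm (conjLocal L (IsCMField.complexConj L) v) (cmLocalForm L 3 v)) :=
    locallyCompactSpace_local (IsCMField.complexConj L) 3 _ v
  haveI : SecondCountableTopology ↥(unitaryGroupOfForm (conjLocal L (IsCMField.complexConj L) v) (cmLocalForm L 3 v)) :=
    secondCountableTopology_local (IsCMField.complexConj L) 3 _ v
  haveI : T2Space ↥(unitaryGroupOfForm (conjLocal L (IsCMField.complexConj L) v) (cmLocalForm L 3 v)) :=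
    t2Space_cmDatum_local 3 L (Matrix.of fun i j : Fin 3 => if i.val + j.val + 1 = 3 then (1 : L) else 0) v
  haveI : T1Space (LocalRing L v) := inferInstance
  have hTcl := isClosed_torusU_of_t1Space (conjLocal L (IsCMField.complexConj L) v) (cmLocalForm L 3 v)
  haveI : LocallyCompactSpace ↥(cmBorelTriple L 3 v).M := hTcl.isClosedEmbedding_subtypeVal.locallyCompactSpace
  haveI : SecondCountableTopology ↥(cmBorelTriple L 3 v).M := TopologicalSpace.Subtype.secondCountableTopology _
  haveI : SigmaCompactSpace ↥(cmBorelTriple L 3 v).M := sigmaCompactSpace_of_locallyCompact_secondCountable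
  haveI : RegularSpace ↥(cmBorelTriple L 3 v).M := IsTopologicalGroup.regularSpace _
  haveI : T2Space ↥(cmBorelTriple L 3 v).M := inferInstance
  haveI : T3Space ↥(cmBorelTriple L 3 v).M := @instT3Space _ _ inferInstance inferInstance
  haveI : TopologicalSpace.PseudoMetrizableSpace ↥(cmBorelTriple L 3 v).M :=
    (TopologicalSpace.metrizableSpace_of_t3_secondCountable ↥(cmBorelTriple L 3 v).M).toPseudoMetrizableSpace
  haveI : SigmaFinite μT := inferInstance
  haveI : μT.InnerRegular := Measure.instInnerRegularOfPseudoMetrizableSpaceOfSigmaCompactSpaceOfBorelSpaceOfSigmaFinite μT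
  -- the sequence `t_k = d(U_k, 1, U_k⁻¹) → 1`
  obtain ⟨U, hσU, hU1, hUi1, hUne, hUsq⟩ := exists_units_tendsto_one_conjLocal_eq L v
  have hσUi : ∀ k, conjLocal L (IsCMField.complexConj L) v (((U k)⁻¹ : (LocalRing L v)ˣ) : LocalRing L v) = (((U k)⁻¹ : (LocalRing L v)ˣ) : LocalRing L v) :=
    fun k => Units.eq_inv_of_mul_eq_one_left (by rw [← hσU k, ← map_mul, Units.mul_inv, map_one])
  let d : ℕ → Fin 3 → (LocalRing L v)ˣ := fun k => ![U k, 1, (U k)⁻¹]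
  have hdmem : ∀ k, glDiagonal 3 (LocalRing L v) (d k) ∈ unitaryGroupOfForm (conjLocal L (IsCMField.complexConj L) v) (cmLocalForm L 3 v) := by
    intro k
    rw [cmLocalForm_eq_over, glDiagonal_mem_unitaryGroupOfForm_antidiagonal_iff]
    intro i
    fin_cases i
    · show conjLocal L (IsCMField.complexConj L) v (((U k)⁻¹ : (LocalRing L v)ˣ) : LocalRing L v) * (U k : LocalRing L v) = 1
      rw [hσUi, Units.inv_mul]
    · show conjLocal L (IsCMField.complexConj L) v ((1 : (LocalRing L v)ˣ) : LocalRing L v) * ((1 : (LocalRing L v)ˣ) : LocalRing L v) = 1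
      rw [Units.val_one, map_one, mul_one]
    · show conjLocal L (IsCMField.complexConj L) v (U k : LocalRing L v) * (((U k)⁻¹ : (LocalRing L v)ˣ) : LocalRing L v) = 1
      rw [hσU, Units.mul_inv]
  let tk : ℕ → ↥(cmBorelTriple L 3 v).M := fun k => ⟨⟨glDiagonal 3 (LocalRing L v) (d k), hdmem k⟩, ⟨d k, rfl⟩⟩
  have hentry : ∀ k i, torusEntry (conjLocal L (IsCMField.complexConj L) v) (cmLocalForm L 3 v) i (tk k) = d k i :=
    fun k i => torusEntry_eq_of_glDiagonal_eq _ _ i (tk k) (d k) rfl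
  have h1 : (1 : Matrix (Fin 3) (Fin 3) (LocalRing L v)) = Matrix.diagonal (fun _ => (1 : LocalRing L v)) := Matrix.diagonal_one.symm
  have hA : Tendsto (fun k => (glDiagonal 3 (LocalRing L v) (d k)).val) atTop (𝓝 (1 : Matrix (Fin 3) (Fin 3) (LocalRing L v))) := by
    have hval : ∀ k, (glDiagonal 3 (LocalRing L v) (d k)).val = Matrix.diagonal (fun i => ((d k i : (LocalRing L v)ˣ) : LocalRing L v)) :=
      fun k => coe_glDiagonal 3 _ (d k)
    simp only [hval]
    rw [h1]
    refine ((continuous_id.matrix_diagonal).tendsto (fun _ : Fin 3 => (1 : LocalRing L v))).comp (tendsto_pi_nhds.2 fun i => ?_)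
    fin_cases i
    · exact hU1
    · exact tendsto_const_nhds
    · exact hUi1
  have hB : Tendsto (fun k => ((glDiagonal 3 (LocalRing L v) (d k))⁻¹).val) atTop (𝓝 (1 : Matrix (Fin 3) (Fin 3) (LocalRing L v))) := by
    have hval : ∀ k, ((glDiagonal 3 (LocalRing L v) (d k))⁻¹).val = Matrix.diagonal (fun i => (((d k i)⁻¹ : (LocalRing L v)ˣ) : LocalRing L v)) :=
      fun k => by rw [← map_inv]; exact coe_glDiagonal 3 _ (d k)⁻¹
    simp only [hval]
    rw [h1]
    refine ((continuous_id.matrix_diagonal).tendsto (fun _ : Fin 3 => (1 : LocalRing L v))).comp (tendsto_pi_nhds.2 fun i => ?_)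
    fin_cases i
    · exact hUi1
    · show Tendsto (fun k => (((1 : (LocalRing L v)ˣ)⁻¹ : (LocalRing L v)ˣ) : LocalRing L v)) atTop (𝓝 1)
      rw [inv_one, Units.val_one]; exact tendsto_const_nhds
    · show Tendsto (fun k => ((((U k)⁻¹)⁻¹ : (LocalRing L v)ˣ) : LocalRing L v)) atTop (𝓝 1)
      simp only [inv_inv]; exact hU1
  have htend : Tendsto tk atTop (𝓝 1) := by
    rw [Topology.IsInducing.subtypeVal.tendsto_nhds_iff, Topology.IsInducing.subtypeVal.tendsto_nhds_iff,
      Units.isInducing_embedProduct.tendsto_nhds_iff]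
    have hone : Units.embedProduct (Matrix (Fin 3) (Fin 3) (LocalRing L v))
        ((((1 : ↥(cmBorelTriple L 3 v).M) : ↥(unitaryGroupOfForm (conjLocal L (IsCMField.complexConj L) v) (cmLocalForm L 3 v))) :
          GL (Fin 3) (LocalRing L v))) = ((1 : Matrix (Fin 3) (Fin 3) (LocalRing L v)), MulOpposite.op 1) := by
      rw [OneMemClass.coe_one, OneMemClass.coe_one, Units.embedProduct_apply, inv_one, Units.val_one]
    rw [hone]
    exact Tendsto.congr (fun k => rfl) (hA.prodMk_nhds ((MulOpposite.continuous_op.tendsto _).comp hB))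
  -- the wall `{(d₁⁻¹ d₂)_w = 1}` is a closed subgroup avoided by `t_k` (ratio `U_k⁻¹`), hence null
  have hnull : ∀ w : PlacesOver L v,
      μT {t | (((torusEntry (conjLocal L (IsCMField.complexConj L) v) (cmLocalForm L 3 v) 1 t)⁻¹ *
        torusEntry (conjLocal L (IsCMField.complexConj L) v) (cmLocalForm L 3 v) 2 t : (LocalRing L v)ˣ) : LocalRing L v) w = 1} = 0 := by
    intro w
    obtain ⟨H, hH, hHcl⟩ := exists_subgroup_ratio_apply_eq_one_aux L v (cmLocalForm L 3 v) 1 2 w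
    have hset : {t : ↥(cmBorelTriple L 3 v).M | (((torusEntry (conjLocal L (IsCMField.complexConj L) v) (cmLocalForm L 3 v) 1 t)⁻¹ *
        torusEntry (conjLocal L (IsCMField.complexConj L) v) (cmLocalForm L 3 v) 2 t : (LocalRing L v)ˣ) : LocalRing L v) w = 1} = H := by
      ext t; exact (hH t).symm
    rw [hset]
    refine measure_subgroup_eq_zero_of_tendsto μT H hHcl.measurableSet htend (Filter.Eventually.frequently ?_)
    filter_upwards [hUsq] with k _hk
    rw [hH, hentry, hentry]
    have hab : (U k : LocalRing L v) w * (((U k)⁻¹ : (LocalRing L v)ˣ) : LocalRing L v) w = 1 := by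
      have := congr_fun (Units.mul_inv (U k)) w
      rwa [Pi.mul_apply, Pi.one_apply] at this
    show ¬ ((((1 : (LocalRing L v)ˣ)⁻¹ * (U k)⁻¹ : (LocalRing L v)ˣ) : LocalRing L v) w = 1)
    rw [inv_one, one_mul]
    intro h
    apply hUne k w
    rw [h, mul_one] at hab
    exact hab
  have hwall : ∀ x : (LocalRing L v)ˣ, ¬ IsUnit ((x : LocalRing L v) - 1) → ∃ w : PlacesOver L v, (x : LocalRing L v) w = 1 := by
    intro x hx
    by_contra hall
    exact hx (Pi.isUnit_iff.2 fun w => isUnit_iff_ne_zero.2 (sub_ne_zero.2 fun h => hall ⟨w, h⟩))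
  rw [ae_iff]
  refine measure_mono_null (t := ⋃ w : PlacesOver L v,
    {t | (((torusEntry (conjLocal L (IsCMField.complexConj L) v) (cmLocalForm L 3 v) 1 t)⁻¹ *
        torusEntry (conjLocal L (IsCMField.complexConj L) v) (cmLocalForm L 3 v) 2 t : (LocalRing L v)ˣ) : LocalRing L v) w = 1}) ?_ ?_
  · intro t ht
    rw [Set.mem_setOf_eq] at ht
    rw [Set.mem_iUnion]
    exact hwall _ ht
  · exact measure_iUnion_null_iff.2 fun w => hnull w

/-- **Regular torus elements have full measure (pairwise form)**: for every Haar `μ_T` on `T₃ = (cmBorelTriple L 3 v).M`, `μ_T`-a.e. `t` has all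
`dᵢ − dⱼ` (`i ≠ j`) units of `∏_{w ∣ v} L_w` and `d₀⁻¹d₁ − 1`, `d₀⁻¹d₂ − 1` units (`dᵢ = torusEntry i t`) — the binders `(hreg, ha', hb')` of ★
`classOrbitalIntegral_eq_smul_integral_prod_of_torus_regular`. [cite: Rogawski1990, §4.9 p. 55; §12.5 p. 183] [cite: HarishChandra1970, §3] -/
theorem ae_isUnit_torusEntry_sub_three
    [MeasurableSpace ↥(unitaryGroupOfForm (conjLocal L (IsCMField.complexConj L) v) (cmLocalForm L 3 v))]
    [BorelSpace ↥(unitaryGroupOfForm (conjLocal L (IsCMField.complexConj L) v) (cmLocalForm L 3 v))]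
    (μT : Measure ↥(cmBorelTriple L 3 v).M) [μT.IsHaarMeasure] :
    ∀ᵐ t ∂μT,
      (∀ i j : Fin 3, i ≠ j → IsUnit (((torusEntry (conjLocal L (IsCMField.complexConj L) v) (cmLocalForm L 3 v) i t : (LocalRing L v)ˣ) : LocalRing L v) -
          (torusEntry (conjLocal L (IsCMField.complexConj L) v) (cmLocalForm L 3 v) j t : (LocalRing L v)ˣ))) ∧
      IsUnit ((((torusEntry (conjLocal L (IsCMField.complexConj L) v) (cmLocalForm L 3 v) 0 t)⁻¹ *
          torusEntry (conjLocal L (IsCMField.complexConj L) v) (cmLocalForm L 3 v) 1 t : (LocalRing L v)ˣ) : LocalRing L v) - 1) ∧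
      IsUnit ((((torusEntry (conjLocal L (IsCMField.complexConj L) v) (cmLocalForm L 3 v) 0 t)⁻¹ *
          torusEntry (conjLocal L (IsCMField.complexConj L) v) (cmLocalForm L 3 v) 2 t : (LocalRing L v)ˣ) : LocalRing L v) - 1) := by
  filter_upwards [ae_isUnit_torusRatio_sub_one_three L v μT, ae_isUnit_torusRatio_sub_one_three_one_two L v μT] with t h01 h12
  refine ⟨?_, h01.1, h01.2⟩
  have h01' := isUnit_sub_of_isUnit_inv_mul_sub_one _ _ h01.1
  have h02' := isUnit_sub_of_isUnit_inv_mul_sub_one _ _ h01.2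
  have h12' := isUnit_sub_of_isUnit_inv_mul_sub_one _ _ h12
  intro i j hij
  fin_cases i <;> fin_cases j
  · exact absurd rfl hij
  · exact h01'.1
  · exact h02'.1
  · exact h01'.2
  · exact absurd rfl hij
  · exact h12'.1
  · exact h02'.2
  · exact h12'.2
  · exact absurd rfl hij

end Three

section Two

variable (L : Type) [Field L] [NumberField L] [IsCMField L] (v : HeightOneSpectrum (𝓞 ↥(maximalRealSubfield L)))

/-- **Regular torus elements have full measure (pairwise form, `N = 2`)**: for every Haar `μ_T` on `T₂ = (cmBorelTriple L 2 v).M`, `μ_T`-a.e. `t` has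
`d₀ − d₁`, `d₁ − d₀` and `d₀⁻¹d₁ − 1` units of `∏_{w ∣ v} L_w`. [cite: Rogawski1990, §4.9 p. 55; §12.5 p. 183] [cite: HarishChandra1970, §3] -/
theorem ae_isUnit_torusEntry_sub_two
    [MeasurableSpace ↥(unitaryGroupOfForm (conjLocal L (IsCMField.complexConj L) v) (cmLocalForm L 2 v))]
    [BorelSpace ↥(unitaryGroupOfForm (conjLocal L (IsCMField.complexConj L) v) (cmLocalForm L 2 v))]
    (μT : Measure ↥(cmBorelTriple L 2 v).M) [μT.IsHaarMeasure] :
    ∀ᵐ t ∂μT,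
      IsUnit (((torusEntry (conjLocal L (IsCMField.complexConj L) v) (cmLocalForm L 2 v) 0 t : (LocalRing L v)ˣ) : LocalRing L v) -
          (torusEntry (conjLocal L (IsCMField.complexConj L) v) (cmLocalForm L 2 v) 1 t : (LocalRing L v)ˣ)) ∧
      IsUnit (((torusEntry (conjLocal L (IsCMField.complexConj L) v) (cmLocalForm L 2 v) 1 t : (LocalRing L v)ˣ) : LocalRing L v) -
          (torusEntry (conjLocal L (IsCMField.complexConj L) v) (cmLocalForm L 2 v) 0 t : (LocalRing L v)ˣ)) ∧
      IsUnit ((((torusEntry (conjLocal L (IsCMField.complexConj L) v) (cmLocalForm L 2 v) 0 t)⁻¹ *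
          torusEntry (conjLocal L (IsCMField.complexConj L) v) (cmLocalForm L 2 v) 1 t : (LocalRing L v)ˣ) : LocalRing L v) - 1) := by
  filter_upwards [ae_isUnit_torusRatio_sub_one_two L v μT] with t h01
  have h := isUnit_sub_of_isUnit_inv_mul_sub_one _ _ h01
  exact ⟨h.1, h.2, h01⟩

end Two

end UnitaryGroup

end Literature.NumberTheory.Automorphic
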